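import Literature.MathematicalPhysics.QuantumLattice.OnSitePairingAlgebra
import HarnessLib

/-!
# The on-site pairing (BCS/Bogoliubov) block, II: `e^{-βX}` and `Tr e^{-β[ξ(n↑+n↓) + Δ(c↓c↑ + h.c.)]}`

Topic `MathematicalPhysics/QuantumLattice`; continuation of `OnSitePairingAlgebra.lean` (two
distinct orbitals `a ≠ b` of the Jordan–Wigner Fock space `Fock ι`, pair operator `P = c_b c_a`,
`N' = n_a + n_b - 1`, `S = P + Pᴴ`, even projection `Q = N'² = 1 - n_a - n_b + 2n_a n_b`, block
`X = ξN' + ΔS` with `X² = (ξ²+Δ²)Q`, `QX = XQ = X`). Proved here: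

* `exp_neg_smul_bdgBlock` — for ABSTRACT matrices with `Q² = Q`, `QX = XQ = X`, `X² = E²Q`,
  `E > 0`: `e^{-βX} = 1 + (cosh(βE) - 1)Q - (sinh(βE)/E)X` (spectral projections
  `R_± = (Q ± E⁻¹X)/2`, `e^{cR} = 1 + (e^c - 1)R`); `trace_exp_neg_smul_bdgBlock` — if moreover
  `Tr X = 0`, `Tr e^{-βX} = |n| + (cosh(βE) - 1) Tr Q`;
* traces of the two-mode operators by cyclicity and the CAR: `Tr (c_b c_a) = 0`,
  `Tr n_i = 2^{|ι|}/2`, `Tr (n_a n_b) = 2^{|ι|}/4` (trace factorisation over `{a}`, `{b}`),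
  `Tr Q = 2^{|ι|}/2`, `Tr X = 0`;
* **`trace_exp_neg_smul_bdgPair`** — for all real `ξ, Δ, β`:
  `Tr exp(-β[ξ(n_a + n_b) + Δ(c_b c_a + c†_a c†_b)]) = 2^{|ι|} e^{-βξ} (1 + cosh(β√(ξ²+Δ²)))/2`
  (`= 2^{|ι|-2}(2e^{-βξ} + e^{-β(ξ-E)} + e^{-β(ξ+E)})`: the two-mode levels `ξ, ξ, ξ ∓ E` times
  `2^{|ι|-2}` spectators) — the one-mode-pair factor of the BCS/BdG partition function
  (Bardeen–Cooper–Schrieffer 1957 §III; de Gennes 1966 Ch. 4; von Delft–Ralph 2001 §4.2).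

Everything is proved; no definition and no named fact.

## Mathlib / tree search

Tree: part I; `trace_mul_of_mem_carSubalgebra`, `creation_mem_carSubalgebra`,
`annihilation_mem_carSubalgebra` (`FermionTraceFactorization`). Mathlib: `Matrix.exp_add_of_commute`,
`Matrix.exp_diagonal`, `Pi.coe_exp`, `Complex.exp_eq_exp_ℂ`, `Matrix.trace_mul_comm`,
`Matrix.trace_one`, `Fintype.card_finset`, `Complex.ofReal_cosh/sinh`.

## References

* J. Bardeen, L. N. Cooper, J. R. Schrieffer, Phys. Rev. 108 (1957) 1175, §III.
* P. G. de Gennes, *Superconductivity of Metals and Alloys* (Benjamin 1966), Ch. 4–5. [deGennes1966]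
* J. von Delft, D. C. Ralph, Phys. Rep. 345 (2001) 61, §4.2. [VondelftRalph2001]
-/

noncomputable section

namespace Literature.MathematicalPhysics.QuantumLattice

open Matrix Finset HubbardWave0 LiebThm1
open scoped Matrix.Norms.L2Operator

/-! ### Exponential and trace of an abstract BdG block `X² = E² Q`, `QX = XQ = X`, `Q² = Q` -/

section AbstractBlock

variable {n : Type*} [Fintype n] [DecidableEq n]

/-- **Exponential of a BdG block.** If `Q² = Q`, `QX = XQ = X` and `X² = E²Q` with `E > 0`, then
`e^{-βX} = 1 + (cosh(βE) - 1) Q - (sinh(βE)/E) X` (spectral decomposition `X = E(R₊ - R₋)`,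
`R_± = (Q ± E⁻¹X)/2` orthogonal idempotents). [folklore] -/
theorem exp_neg_smul_bdgBlock {Q X : Matrix n n ℂ} {E : ℝ} (hE : 0 < E) (hQ : Q * Q = Q)
    (hQX : Q * X = X) (hXQ : X * Q = X) (hX : X * X = ((E ^ 2 : ℝ) : ℂ) • Q) (β : ℝ) :
    NormedSpace.exp (-(β : ℂ) • X) =
      1 + ((Real.cosh (β * E) - 1 : ℝ) : ℂ) • Q - ((Real.sinh (β * E) / E : ℝ) : ℂ) • X := by
  have hE0 : (E : ℂ) ≠ 0 := by exact_mod_cast hE.ne'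
  -- `Y = E⁻¹ X`, so that `X = E Y`, `Q Y = Y Q = Y`, `Y² = Q`
  obtain ⟨Y, hY⟩ : ∃ Y : Matrix n n ℂ, Y = (E : ℂ)⁻¹ • X := ⟨_, rfl⟩
  have hXY : X = (E : ℂ) • Y := by rw [hY, smul_smul, mul_inv_cancel₀ hE0, one_smul]
  have hQY : Q * Y = Y := by rw [hY, mul_smul_comm, hQX]
  have hYQ : Y * Q = Y := by rw [hY, smul_mul_assoc, hXQ]
  have hYY : Y * Y = Q := by
    rw [hY, smul_mul_smul_comm, hX, smul_smul]
    have h1 : ((E : ℂ)⁻¹ * (E : ℂ)⁻¹ * ((E ^ 2 : ℝ) : ℂ)) = 1 := by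
      push_cast
      field_simp
    rw [h1, one_smul]
  -- the spectral projections `R_± = (Q ± Y)/2`
  obtain ⟨Rp, hRp⟩ : ∃ Rp : Matrix n n ℂ, Rp = (1 / 2 : ℂ) • (Q + Y) := ⟨_, rfl⟩
  obtain ⟨Rm, hRm⟩ : ∃ Rm : Matrix n n ℂ, Rm = (1 / 2 : ℂ) • (Q - Y) := ⟨_, rfl⟩
  have hRpRp : IsIdempotentElem Rp := by
    change Rp * Rp = Rp
    rw [hRp, smul_mul_smul_comm, add_mul, mul_add, mul_add, hQ, hQY, hYQ, hYY]
    module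
  have hRmRm : IsIdempotentElem Rm := by
    change Rm * Rm = Rm
    rw [hRm, smul_mul_smul_comm, sub_mul, mul_sub, mul_sub, hQ, hQY, hYQ, hYY]
    module
  have hRpRm : Rp * Rm = 0 := by
    rw [hRp, hRm, smul_mul_smul_comm, add_mul, mul_sub, mul_sub, hQ, hQY, hYQ, hYY]
    module
  have hRmRp : Rm * Rp = 0 := by
    rw [hRp, hRm, smul_mul_smul_comm, sub_mul, mul_add, mul_add, hQ, hQY, hYQ, hYY]
    module
  obtain ⟨ep, hep⟩ : ∃ ep : ℂ, ep = Complex.exp ((β * E : ℝ) : ℂ) := ⟨_, rfl⟩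
  obtain ⟨em, hem⟩ : ∃ em : ℂ, em = Complex.exp (-((β * E : ℝ) : ℂ)) := ⟨_, rfl⟩
  have hdec : -(β : ℂ) • X = (-((β * E : ℝ) : ℂ)) • Rp + ((β * E : ℝ) : ℂ) • Rm := by
    rw [hXY, hRp, hRm]
    push_cast
    module
  have hcomm : Commute ((-((β * E : ℝ) : ℂ)) • Rp) (((β * E : ℝ) : ℂ) • Rm) := by
    change _ * _ = _ * _
    rw [smul_mul_smul_comm, smul_mul_smul_comm, hRpRm, hRmRp, smul_zero, smul_zero]
  rw [hdec, Matrix.exp_add_of_commute _ _ hcomm, exp_smul_of_isIdempotentElem hRpRp,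
    exp_smul_of_isIdempotentElem hRmRm, ← hep, ← hem]
  simp only [add_mul, mul_add, one_mul, mul_one, smul_mul_smul_comm, hRpRm, smul_zero, add_zero]
  -- back to `Q` and `X`
  have hcosh : ((Real.cosh (β * E) - 1 : ℝ) : ℂ) = (ep + em) / 2 - 1 := by
    rw [hep, hem]
    push_cast
    rw [Complex.cosh]
  have hsinh : ((Real.sinh (β * E) / E : ℝ) : ℂ) = (ep - em) / 2 * (E : ℂ)⁻¹ := by
    rw [hep, hem]
    push_cast
    rw [Complex.sinh, div_eq_mul_inv _ (E : ℂ)]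
  rw [hcosh, hsinh, hRp, hRm, hY]
  module

/-- **Trace of the exponential of a traceless BdG block**: under the hypotheses of
`exp_neg_smul_bdgBlock` and `Tr X = 0`, `Tr e^{-βX} = |n| + (cosh(βE) - 1) Tr Q`. [folklore] -/
theorem trace_exp_neg_smul_bdgBlock {Q X : Matrix n n ℂ} {E : ℝ} (hE : 0 < E) (hQ : Q * Q = Q)
    (hQX : Q * X = X) (hXQ : X * Q = X) (hX : X * X = ((E ^ 2 : ℝ) : ℂ) • Q) (htr : X.trace = 0)
    (β : ℝ) :
    (NormedSpace.exp (-(β : ℂ) • X)).trace =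
      (Fintype.card n : ℂ) + ((Real.cosh (β * E) - 1 : ℝ) : ℂ) * Q.trace := by
  rw [exp_neg_smul_bdgBlock hE hQ hQX hXQ hX β, trace_sub, trace_add, trace_one, trace_smul,
    trace_smul, htr, smul_zero, sub_zero, smul_eq_mul]

end AbstractBlock

/-! ### Traces of the two-mode operators -/

section Traces

variable {ι : Type*} [LinearOrder ι] [Fintype ι]

/-- `Tr 1 = 2^{|ι|}` on the Fock space. [folklore] -/
theorem trace_one_fock : (1 : Matrix (Finset ι) (Finset ι) ℂ).trace = (2 : ℂ) ^ Fintype.card ι := by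
  rw [Matrix.trace_one, Fintype.card_finset]
  push_cast
  rfl

/-- **`Tr (c_b c_a) = 0`** (cyclicity and `c_a c_b = -c_b c_a`). [folklore] -/
theorem trace_annihilation_mul_annihilation (a b : ι) :
    (annihilation b * annihilation a : Matrix (Finset ι) (Finset ι) ℂ).trace = 0 := by
  have h := Matrix.trace_mul_comm (annihilation b) (annihilation a : Matrix (Finset ι) (Finset ι) ℂ)
  rw [annihilation_mul_annihilation_eq_neg a b, trace_neg] at h
  linear_combination (1 / 2 : ℂ) * h

/-- `Tr (c_b c_a)ᴴ = 0`. [folklore] -/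
theorem trace_pair_conjTranspose (a b : ι) :
    ((annihilation b * annihilation a)ᴴ : Matrix (Finset ι) (Finset ι) ℂ).trace = 0 := by
  rw [trace_conjTranspose, trace_annihilation_mul_annihilation, star_zero]

/-- **`Tr n_i = 2^{|ι|} / 2`** (cyclicity: `Tr c†c = Tr cc† = Tr (1 - c†c)`). [folklore] -/
theorem trace_numberAt (i : ι) : (numberAt i : Matrix (Finset ι) (Finset ι) ℂ).trace = (2 : ℂ) ^ Fintype.card ι / 2 := by
  have h := Matrix.trace_mul_comm (creation i) (annihilation i : Matrix (Finset ι) (Finset ι) ℂ)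
  rw [annihilation_mul_creation, if_pos rfl, trace_sub, trace_one_fock] at h
  rw [numberAt]
  linear_combination (1 / 2 : ℂ) * h

/-- `n_i` lies in the CAR subalgebra of `{i}`. [folklore] -/
theorem numberAt_mem_carSubalgebra_singleton (i : ι) : numberAt i ∈ carSubalgebra ({i} : Finset ι) :=
  Subalgebra.mul_mem _ (creation_mem_carSubalgebra (Finset.mem_singleton_self i))
    (annihilation_mem_carSubalgebra (Finset.mem_singleton_self i))

/-- **`Tr (n_a n_b) = 2^{|ι|} / 4`** for `a ≠ b` (trace factorisation over the disjoint orbital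
sets `{a}`, `{b}`). [folklore] -/
theorem trace_numberAt_mul_numberAt {a b : ι} (hab : a ≠ b) :
    (numberAt a * numberAt b : Matrix (Finset ι) (Finset ι) ℂ).trace = (2 : ℂ) ^ Fintype.card ι / 4 := by
  have h := trace_mul_of_mem_carSubalgebra (numberAt_mem_carSubalgebra_singleton a)
    (numberAt_mem_carSubalgebra_singleton b) (Finset.disjoint_singleton.2 hab)
  rw [trace_numberAt, trace_numberAt] at h
  have h2 : (2 : ℂ) ^ Fintype.card ι ≠ 0 := pow_ne_zero _ two_ne_zero
  field_simp at h
  field_simp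
  linear_combination h

/-- `Tr Q = 2^{|ι|} / 2` for the even projection `Q = 1 - n_a - n_b + 2 n_a n_b`. [folklore] -/
theorem trace_evenProj {a b : ι} (hab : a ≠ b) :
    (1 - numberAt a - numberAt b + 2 • (numberAt a * numberAt b) : Matrix (Finset ι) (Finset ι) ℂ).trace =
      (2 : ℂ) ^ Fintype.card ι / 2 := by
  rw [trace_add, trace_sub, trace_sub, trace_one_fock, trace_numberAt, trace_numberAt, trace_smul,
    trace_numberAt_mul_numberAt hab]
  simp only [nsmul_eq_mul]
  push_cast
  ring

/-- The BdG block `X = ξ N' + Δ S` is traceless. [folklore] -/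
theorem trace_bdgBlock (a b : ι) (ξ Δ : ℝ) :
    ((ξ : ℂ) • (numberAt a + numberAt b - 1) +
        (Δ : ℂ) • (annihilation b * annihilation a + (annihilation b * annihilation a)ᴴ) :
          Matrix (Finset ι) (Finset ι) ℂ).trace = 0 := by
  rw [trace_add, trace_smul, trace_smul, trace_sub, trace_add, trace_numberAt, trace_numberAt,
    trace_one_fock, trace_add, trace_annihilation_mul_annihilation, trace_pair_conjTranspose]
  simp only [smul_eq_mul]
  ring

end Traces

/-! ### The trace of the two-mode BdG Gibbs weight -/

section OnSiteTrace

variable {ι : Type*} [LinearOrder ι] [Fintype ι]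

/-- `e^{c·1} = e^c · 1` for matrices. [folklore] -/
theorem exp_smul_one_matrix (c : ℂ) :
    NormedSpace.exp (c • (1 : Matrix (Finset ι) (Finset ι) ℂ)) = Complex.exp c • (1 : Matrix (Finset ι) (Finset ι) ℂ) := by
  have h1 : c • (1 : Matrix (Finset ι) (Finset ι) ℂ) = diagonal fun _ => c := by
    ext i j
    simp [Matrix.one_apply, diagonal_apply]
  rw [h1, Matrix.exp_diagonal]
  ext i j
  simp only [diagonal_apply, Matrix.smul_apply, Matrix.one_apply, smul_eq_mul, mul_ite, mul_one, mul_zero,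
    Pi.coe_exp, Complex.exp_eq_exp_ℂ]

/-- **Trace of the two-mode BdG Gibbs weight.** For distinct orbitals `a ≠ b` and real `ξ, Δ, β`,
`Tr exp(-β [ξ (n_a + n_b) + Δ (c_b c_a + c†_a c†_b)]) = 2^{|ι|} · e^{-βξ} (1 + cosh(β√(ξ²+Δ²)))/2`
(`= 2^{|ι|-2} (2 e^{-βξ} + e^{-β(ξ-E)} + e^{-β(ξ+E)})`: the four two-mode levels `ξ, ξ, ξ ∓ E`
times the `2^{|ι|-2}` spectator states). [cite: VondelftRalph2001, §4.2] -/
theorem trace_exp_neg_smul_bdgPair {a b : ι} (hab : a ≠ b) (ξ Δ β : ℝ) :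
    (NormedSpace.exp (-(β : ℂ) • ((ξ : ℂ) • (numberAt a + numberAt b) +
        (Δ : ℂ) • (annihilation b * annihilation a + (annihilation b * annihilation a)ᴴ)))).trace =
      (2 : ℂ) ^ Fintype.card ι *
        ((Real.exp (-(β * ξ)) * ((1 + Real.cosh (β * Real.sqrt (ξ ^ 2 + Δ ^ 2))) / 2) : ℝ) : ℂ) := by
  -- split off the scalar `ξ · 1`
  set X : Matrix (Finset ι) (Finset ι) ℂ := (ξ : ℂ) • (numberAt a + numberAt b - 1) +
    (Δ : ℂ) • (annihilation b * annihilation a + (annihilation b * annihilation a)ᴴ) with hXdef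
  have hsplit : -(β : ℂ) • ((ξ : ℂ) • (numberAt a + numberAt b) +
      (Δ : ℂ) • (annihilation b * annihilation a + (annihilation b * annihilation a)ᴴ)) =
      (-(β * ξ : ℝ) : ℂ) • (1 : Matrix (Finset ι) (Finset ι) ℂ) + -(β : ℂ) • X := by
    rw [hXdef]
    push_cast
    module
  have hcomm : Commute ((-(β * ξ : ℝ) : ℂ) • (1 : Matrix (Finset ι) (Finset ι) ℂ)) (-(β : ℂ) • X) :=
    ((Commute.one_left X).smul_left _).smul_right _
  rw [hsplit, Matrix.exp_add_of_commute _ _ hcomm, exp_smul_one_matrix, smul_mul_assoc, one_mul,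
    trace_smul, smul_eq_mul]
  -- the traceless block
  have htrX : X.trace = 0 := trace_bdgBlock a b ξ Δ
  by_cases hE : ξ ^ 2 + Δ ^ 2 = 0
  · -- degenerate block: `ξ = Δ = 0`
    have hξ : ξ = 0 := by nlinarith [sq_nonneg ξ, sq_nonneg Δ]
    have hΔ : Δ = 0 := by nlinarith [sq_nonneg ξ, sq_nonneg Δ]
    have hX0 : X = 0 := by rw [hXdef, hξ, hΔ]; simp
    rw [hX0, smul_zero, NormedSpace.exp_zero, trace_one_fock, hξ, hΔ]
    push_cast
    simp
  · have hpos : 0 < ξ ^ 2 + Δ ^ 2 := lt_of_le_of_ne (by positivity) (Ne.symm hE)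
    set E := Real.sqrt (ξ ^ 2 + Δ ^ 2) with hEdef
    have hE0 : 0 < E := Real.sqrt_pos.2 hpos
    have hEsq : E ^ 2 = ξ ^ 2 + Δ ^ 2 := Real.sq_sqrt hpos.le
    have hXX : X * X = ((E ^ 2 : ℝ) : ℂ) •
        (1 - numberAt a - numberAt b + 2 • (numberAt a * numberAt b) : Matrix (Finset ι) (Finset ι) ℂ) := by
      rw [hEsq, hXdef]
      exact bdgBlock_sq hab ξ Δ
    rw [trace_exp_neg_smul_bdgBlock hE0 (evenProj_mul_evenProj a b) (evenProj_mul_bdgBlock hab ξ Δ)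
      (bdgBlock_mul_evenProj hab ξ Δ) hXX htrX β, trace_evenProj hab, Fintype.card_finset]
    push_cast
    ring

end OnSiteTrace

/-! ### Sums of on-site BdG blocks over the sites of a Hubbard lattice: the trace factorises -/

section Lattice

variable {Λ : Type*} [LinearOrder Λ] [Fintype Λ]

/-- The on-site pair operator `c_{x↓} c_{x↑}` is an even local operator of `x`. [cite: BratteliRobinsonII1997, §5.2.2 (even subalgebra)] -/
theorem onSitePairOp_mem {A : Finset Λ} {x : Λ} (hx : x ∈ A) :
    annihilation (orb x 1) * annihilation (orb x 0) ∈ carEvenSubalgebra (orbs A) := by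
  refine Algebra.subset_adjoin ⟨(orb x 1, false), (orb x 0, false), orb_mem_orbs.2 hx, orb_mem_orbs.2 hx, ?_⟩
  simp [letterOp]

/-- Its adjoint `c†_{x↑} c†_{x↓}` is an even local operator of `x`. [cite: BratteliRobinsonII1997, §5.2.2 (even subalgebra)] -/
theorem onSitePairOp_conjTranspose_mem {A : Finset Λ} {x : Λ} (hx : x ∈ A) :
    (annihilation (orb x 1) * annihilation (orb x 0))ᴴ ∈ carEvenSubalgebra (orbs A) := by
  rw [conjTranspose_mul, annihilation_conjTranspose, annihilation_conjTranspose]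
  refine Algebra.subset_adjoin ⟨(orb x 0, true), (orb x 1, true), orb_mem_orbs.2 hx, orb_mem_orbs.2 hx, ?_⟩
  simp [letterOp]

/-- The on-site BdG term `h_x = ξ (n_{x↑} + n_{x↓}) + Δ (c_{x↓}c_{x↑} + h.c.)` is an even local
operator of `x`. [cite: BratteliRobinsonII1997, §5.2.2 (even subalgebra)] -/
theorem onSiteBdG_mem {A : Finset Λ} {x : Λ} (hx : x ∈ A) (ξ Δ : ℂ) :
    ξ • (numberOp x 0 + numberOp x 1) +
        Δ • (annihilation (orb x 1) * annihilation (orb x 0) + (annihilation (orb x 1) * annihilation (orb x 0))ᴴ) ∈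
      carEvenSubalgebra (orbs A) :=
  Subalgebra.add_mem _ (Subalgebra.smul_mem _ (Subalgebra.add_mem _ (numberOp_mem hx 0) (numberOp_mem hx 1)) _)
    (Subalgebra.smul_mem _ (Subalgebra.add_mem _ (onSitePairOp_mem hx) (onSitePairOp_conjTranspose_mem hx)) _)

/-- **BdG partition function of independent sites.** For site-dependent real `ξ_x, Δ_x` and
`H_A = Σ_{x ∈ A} [ξ_x (n_{x↑} + n_{x↓}) + Δ_x (c_{x↓}c_{x↑} + c†_{x↑}c†_{x↓})]`,
`Tr e^{-β H_A} = 2^{2|Λ|} Π_{x ∈ A} e^{-βξ_x} (1 + cosh(β√(ξ_x² + Δ_x²)))/2`: the on-site blocks are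
even elements of disjoint CAR subalgebras, so they commute and the normalised trace factorises
(`trace_mul_of_mem_carSubalgebra`), each factor being `trace_exp_neg_smul_bdgPair`.
[cite: VondelftRalph2001, §4.2] -/
theorem trace_exp_neg_smul_sum_onSiteBdG (ξ Δ : Λ → ℝ) (β : ℝ) (A : Finset Λ) :
    (NormedSpace.exp (-(β : ℂ) • ∑ x ∈ A, ((ξ x : ℂ) • (numberOp x 0 + numberOp x 1) +
        (Δ x : ℂ) • (annihilation (orb x 1) * annihilation (orb x 0) +
          (annihilation (orb x 1) * annihilation (orb x 0))ᴴ)))).trace =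
      (2 : ℂ) ^ Fintype.card (Orb Λ) *
        ∏ x ∈ A, ((Real.exp (-(β * ξ x)) * ((1 + Real.cosh (β * Real.sqrt (ξ x ^ 2 + Δ x ^ 2))) / 2) : ℝ) : ℂ) := by
  classical
  induction A using Finset.induction_on with
  | empty =>
    rw [Finset.sum_empty, smul_zero, NormedSpace.exp_zero, Finset.prod_empty, mul_one, trace_one_fock]
  | @insert x A hxA ih =>
    set hloc : Λ → Matrix (Finset (Orb Λ)) (Finset (Orb Λ)) ℂ := fun y => (ξ y : ℂ) • (numberOp y 0 + numberOp y 1) +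
        (Δ y : ℂ) • (annihilation (orb y 1) * annihilation (orb y 0) +
          (annihilation (orb y 1) * annihilation (orb y 0))ᴴ) with hloc_def
    have hx_mem : -(β : ℂ) • hloc x ∈ carEvenSubalgebra (orbs ({x} : Finset Λ)) :=
      Subalgebra.smul_mem _ (onSiteBdG_mem (Finset.mem_singleton_self x) _ _) _
    have hA_mem : -(β : ℂ) • ∑ y ∈ A, hloc y ∈ carSubalgebra (orbs A) := by
      refine Subalgebra.smul_mem _ (Subalgebra.sum_mem _ fun y hy => ?_) _
      exact carEvenSubalgebra_le_carSubalgebra _ (carEvenSubalgebra_mono (orbs_mono (Finset.singleton_subset_iff.2 hy))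
        (onSiteBdG_mem (Finset.mem_singleton_self y) _ _))
    have hdisj : Disjoint (orbs ({x} : Finset Λ)) (orbs A) :=
      disjoint_orbs (Finset.disjoint_singleton_left.2 hxA)
    have hcomm : Commute (-(β : ℂ) • hloc x) (-(β : ℂ) • ∑ y ∈ A, hloc y) :=
      commute_of_mem_carEvenSubalgebra hx_mem hA_mem hdisj
    have hexp_x : NormedSpace.exp (-(β : ℂ) • hloc x) ∈ carSubalgebra (orbs ({x} : Finset Λ)) :=
      exp_mem_subalgebra _ (carEvenSubalgebra_le_carSubalgebra _ hx_mem)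
    have hexp_A : NormedSpace.exp (-(β : ℂ) • ∑ y ∈ A, hloc y) ∈ carSubalgebra (orbs A) :=
      exp_mem_subalgebra _ hA_mem
    have hfac := trace_mul_of_mem_carSubalgebra hexp_x hexp_A hdisj
    rw [ih] at hfac
    have hsite : (NormedSpace.exp (-(β : ℂ) • hloc x)).trace = (2 : ℂ) ^ Fintype.card (Orb Λ) *
        ((Real.exp (-(β * ξ x)) * ((1 + Real.cosh (β * Real.sqrt (ξ x ^ 2 + Δ x ^ 2))) / 2) : ℝ) : ℂ) := by
      rw [hloc_def]
      exact trace_exp_neg_smul_bdgPair (show orb x 0 ≠ orb x 1 by simp [orb]) (ξ x) (Δ x) β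
    rw [hsite] at hfac
    rw [Finset.sum_insert hxA, smul_add, Matrix.exp_add_of_commute _ _ hcomm, Finset.prod_insert hxA]
    have h2 : (2 : ℂ) ^ Fintype.card (Orb Λ) ≠ 0 := pow_ne_zero _ two_ne_zero
    apply mul_right_cancel₀ h2
    rw [hfac]
    ring

end Lattice

end Literature.MathematicalPhysics.QuantumLattice
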